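import Summits.QuantumFields.YangMills.Theorems.BalabanUVNodesN11NoExpansionActionSucc
import Literature.MathematicalPhysics.QuantumFieldTheory.Balaban1983to89.Node00.Sect2FormOfRecord

/-!
# DAG node N11 — A §2 WITNESS TRUNCATED ABOVE LEVEL `k`: its 𝐓-image law package `Sect2.LawsT … k` from the inductive assumptions `Sect2.LawsRT … k` of the untruncated
# witness (zero new terms), and, at a no-expansion new step `Ω_{k+1}(s′) = ∅`, the invariance of (2.23), of the operand `e^{A_{k+1}(s′)}` and of the slot
# `𝐓_{k+1}(s′) e^{A_{k+1}(s′)}` under any change of the witness above level `k`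

Cell `pub-ymgap`, YM-PLAN Track A (HUMAN RULING D-0062), seat `pub-ymgap-dag-n11-e` (g12; R134 fan-out row N11∕s3), route `BalabanUVNodes` rev 25, item K1⁷
`StabilityBAtRecordR13SepCoPH` = stmt-QuantumFields-20542 (helper lane, count-neutral).  [III] = [Balaban1988Convergent].  The generic half of this seat's
`…BalabanUVNodesN11NoExpansionGeneralStepLawsCoPH` (split off by the 400-line rule for Theorems files; that file's header explains the use): 11b ∕ 11c frame bookkeeping
(`Node00.Sect2FrameOfRecord` ∕ `Sect2FormOfRecord`) over dag-n11-d's `…NoExpansionActionSucc` (p531413: the scale-`(k+1)` ranges of (2.25), (2.30), (2.40) are empty at a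
no-expansion step).

WHAT THIS FILE PROVES (0 `sorry`, 0 `def`).  §0 `lawsT_towerOfTerms_of_lawsRT_of_agree_of_vanish` — term values AGREEING with `t` at the levels `≤ k` and VANISHING at level
`k+1` obey r11's 𝐓-image laws `Sect2.LawsT … k` on a frame `(S, Rz, M, Ω)` as soon as `t` obeys `Sect2.LawsRT … k` there, given the RG equation of the flow at `k` and the signs
`0 ≤ E₀, B₀`, `0 ≤ g_{k+1}` (print §2 p. 262 ∕ (3.25): along a no-expansion step there are NO new terms; r11's new-term obligations `LFNewTerms … k` and analyticity at `k+1`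
hold for the ZERO values) · `action23_actionDataOfTerms_congr_of_agree` ((2.23) at index `k` reads the levels `1 … k` only).  §1 (of record, generic setting ∕ residual ∕
weights) `sect2Operand_succ_congr_of_agree_of_Omega_empty` ∕ `sect2Slot_succ_congr_of_agree_of_Omega_empty` — at a no-expansion `s′` neither the operand nor the slot reads the
witness above level `k` (`M ≥ 1`).

HONEST FRAMING.  Count-neutral kernel bookkeeping on the tree's own objects; nothing of Bałaban asserted (no estimate of [III] §3 is used: the improved bounds hold for zero
new terms); N11 NOT discharged; counts unmoved (typed 28∕28 · discharged 5∕27).  One finite `𝕋⁴_{L^K}` programme at fixed `ε = L^{−K}`; NOT ℝ⁴ ∕ OS ∕ mass-gap ∕ Clay.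
Sources: [III] §2 p.262, (2.23)–(2.31) pp.258–260, (2.40)–(2.42) p.261, (3.24)–(3.25) p.270; [Balaban1987RG1] (0.20) p.256.
-/

noncomputable section

open MeasureTheory
open scoped BigOperators Matrix.Norms.L2Operator

namespace Summit.QuantumFields.YangMills.Theorems.BalabanUVNodesN11NoExpansionTruncatedWitness

open Literature.MathematicalPhysics.QuantumFieldTheory.Balaban1983to89 T4Continuum Node00 Node00.Tk
open Step B14.Eq227LocalizedTerms
open BalabanUVNodesN11NoExpansionActionSucc (action23_succ_eq_init_of_Omega_empty)

/-! ## §0. Generic §2 frame — the law package of a witness truncated above level `k`; (2.23) at index `k` reads the levels `1 … k` only -/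

section TruncatedWitness

variable {P : Params} {𝔸 : Type*} [NormedRing 𝔸] [NormedAlgebra ℂ 𝔸] [CompleteSpace 𝔸] {V : Type*} {M : ℕ} {G : Type*} [GaugeGroup G]

/-- **THE LAW PACKAGE OF A TRUNCATED WITNESS** (generic §2 frame): term values `t′` that AGREE with `t` at the levels `≤ k` and VANISH at level `k+1` obey the 𝐓-image laws
`Sect2.LawsT … k` on the frame `(S, Rz, M, Ω)` as soon as `t` obeys the inductive assumptions `Sect2.LawsRT … k` there, given the RG equation of the flow at `k` and the signs
`0 ≤ E₀, B₀`, `0 ≤ g_{k+1}`: old levels verbatim (the frame's spaces do not read the term values), r11's new-term obligations `LFNewTerms … k` and analyticity at `k+1` by the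
ZERO values (norms `0 ≤` the nonnegative right-hand sides; constants are analytic) — print's «no new terms» along a no-expansion step, as bookkeeping.
[cite: Balaban1988Convergent, §2 p.262, (2.27)–(2.31) pp.259–260, (2.41)–(2.42) p.261, (3.25) p.270; Balaban1987RG1, (0.20) p.256] -/
theorem lawsT_towerOfTerms_of_lawsRT_of_agree_of_vanish (S : Sect2.Setting 𝔸 G) (Rz : Sect2.Residual P 𝔸) (Ω : ℕ → Set (Site P 0))
    {k : ℕ} {t t' : Sect2.TermValues P 𝔸 V M}
    (hE : ∀ j, j ≤ k → ∀ X z g φ, t'.E j X z g φ = t.E j X z g φ) (hR : ∀ j, j ≤ k → ∀ X φ, t'.R j X φ = t.R j X φ)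
    (hB : ∀ j, j ≤ k → ∀ X φ a, t'.B j X φ a = t.B j X φ a)
    (hE' : ∀ X z g φ, t'.E (k + 1) X z g φ = 0) (hR' : ∀ X φ, t'.R (k + 1) X φ = 0) (hB' : ∀ X φ a, t'.B (k + 1) X φ a = 0)
    (h : Sect2.LawsRT (Sect2.towerOfTerms S Rz M Ω t) S.lf k)
    (hrg : 1 / (S.flow.g k) ^ 2 = 1 / (S.flow.g (k + 1)) ^ 2 + S.flow.β (k + 1) (S.flow.g k))
    (hE₀ : 0 ≤ S.lf.E₀) (hB₀ : 0 ≤ S.lf.B₀) (hg : 0 ≤ S.flow.g (k + 1)) :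
    Sect2.LawsT (Sect2.towerOfTerms S Rz M Ω t') S.lf S.βc k := by
  obtain ⟨hH, hA⟩ := h
  refine ⟨⟨hH.rg, fun j h1 hj X z g φ ψ hφψ => ?_, fun j h1 hj X φ ψ hφψ => ?_, fun j h1 hj X z g φ hg0 hgγ hφ => ?_,
    fun j h1 hj X φ hφ => ?_, fun j h1 hj X φ a hφ => ?_, fun j h1 hj X z g u φ => ?_, fun j h1 hj X u φ => ?_⟩,
    ⟨hrg, fun X z g φ ψ _ => ?_, fun X φ ψ _ => ?_, fun X z g u φ => ?_, fun X u φ => ?_, ⟨fun _ X z g φ _ _ _ => ?_, fun _ X φ _ => ?_, fun _ X φ a _ => ?_⟩⟩,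
    ⟨fun j h1 hj X z g hg0 hgγ => ?_, fun j h1 hj X => ?_, fun j h1 hj X a => ?_⟩⟩
  · show t'.E j X z g φ = t'.E j X z g ψ
    rw [hE j hj, hE j hj]; exact hH.localDepE j h1 hj X z g φ ψ hφψ
  · show t'.R j X φ = t'.R j X ψ
    rw [hR j hj, hR j hj]; exact hH.localDepR j h1 hj X φ ψ hφψ
  · show ‖t'.E j X z g φ‖ ≤ _
    rw [hE j hj]; exact hH.boundE j h1 hj X z g φ hg0 hgγ hφ
  · show ‖t'.R j X φ‖ ≤ _
    rw [hR j hj]; exact hH.boundR j h1 hj X φ hφ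
  · show ‖t'.B j X φ a‖ ≤ _
    rw [hB j hj]; exact hH.boundB j h1 hj X φ a hφ
  · show t'.E j X z g _ = t'.E j X z g φ
    rw [hE j hj, hE j hj]; exact hH.gaugeInvE j h1 hj X z g u φ
  · show t'.R j X _ = t'.R j X φ
    rw [hR j hj, hR j hj]; exact hH.gaugeInvR j h1 hj X u φ
  · show t'.E (k + 1) X z g φ = t'.E (k + 1) X z g ψ
    rw [hE', hE']
  · show t'.R (k + 1) X φ = t'.R (k + 1) X ψ
    rw [hR', hR']
  · show t'.E (k + 1) X z g _ = t'.E (k + 1) X z g φ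
    rw [hE', hE']
  · show t'.R (k + 1) X _ = t'.R (k + 1) X φ
    rw [hR', hR']
  · show ‖t'.E (k + 1) X z g φ‖ ≤ _
    rw [hE', norm_zero]; exact mul_nonneg hE₀ (Real.exp_nonneg _)
  · show ‖t'.R (k + 1) X φ‖ ≤ _
    rw [hR', norm_zero]; exact mul_nonneg (pow_nonneg hg _) (Real.exp_nonneg _)
  · show ‖t'.B (k + 1) X φ a‖ ≤ _
    rw [hB', norm_zero]; exact mul_nonneg hB₀ (Real.exp_nonneg _)
  · rcases Nat.of_le_succ hj with hj' | rfl
    · have hfun : (Sect2.towerOfTerms S Rz M Ω t').E j X z g = (Sect2.towerOfTerms S Rz M Ω t).E j X z g :=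
        funext fun φ => hE j hj' X z g φ
      rw [hfun]; exact hA.analyticE j h1 hj' X z g hg0 hgγ
    · have hfun : (Sect2.towerOfTerms S Rz M Ω t').E (k + 1) X z g = fun _ => 0 := funext fun φ => hE' X z g φ
      rw [hfun]; exact analyticOnNhd_const
  · rcases Nat.of_le_succ hj with hj' | rfl
    · have hfun : (Sect2.towerOfTerms S Rz M Ω t').R j X = (Sect2.towerOfTerms S Rz M Ω t).R j X := funext fun φ => hR j hj' X φ
      rw [hfun]; exact hA.analyticR j h1 hj' X
    · have hfun : (Sect2.towerOfTerms S Rz M Ω t').R (k + 1) X = fun _ => 0 := funext fun φ => hR' X φ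
      rw [hfun]; exact analyticOnNhd_const
  · rcases Nat.of_le_succ hj with hj' | rfl
    · have hfun : (fun φ => (Sect2.towerOfTerms S Rz M Ω t').B j X φ a) = fun φ => (Sect2.towerOfTerms S Rz M Ω t).B j X φ a :=
        funext fun φ => hB j hj' X φ a
      rw [hfun]; exact hA.analyticB j h1 hj' X a
    · have hfun : (fun φ => (Sect2.towerOfTerms S Rz M Ω t').B (k + 1) X φ a) = fun _ => (0 : ℂ) := funext fun φ => hB' X φ a
      rw [hfun]; exact analyticOnNhd_const

/-- **(2.23) AT INDEX `k` READS THE TERM VALUES AT THE LEVELS `1, …, k` ONLY**: two witnesses agreeing there have the same action `A_k` on the same frame, ranges, fluctuation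
argument and constant (the sums (2.25), (2.30), (2.40) run over `j ∈ [1, k]`). [cite: Balaban1988Convergent, (2.23)–(2.25) pp.258–259, (2.30) p.260, (2.40) p.261] -/
theorem action23_actionDataOfTerms_congr_of_agree (S : Sect2.Setting 𝔸 G) (Rz : Sect2.Residual P 𝔸) (ν : Stage7Numerics) (g : ℕ → ℝ)
    (Ω Λ : ℕ → Set (Site P 0)) {k : ℕ} {t t' : Sect2.TermValues P 𝔸 V M}
    (hE : ∀ j, j ≤ k → ∀ X z g φ, t'.E j X z g φ = t.E j X z g φ) (hR : ∀ j, j ≤ k → ∀ X φ, t'.R j X φ = t.R j X φ)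
    (hB : ∀ j, j ≤ k → ∀ X φ a, t'.B j X φ a = t.B j X φ a) (a : Tk.SFluct P V) (Ek : ℝ) (U : GaugeField P 0 G) :
    (Sect2.actionDataOfTerms S Rz ν M g Ω Λ t' k a Ek).action23 k U = (Sect2.actionDataOfTerms S Rz ν M g Ω Λ t k a Ek).action23 k U := by
  rw [Sect2.action23_actionDataOfTerms, Sect2.action23_actionDataOfTerms]
  have h1 : B14.Eq225Concrete.E225 (Sect2.towerOfTerms S Rz M Ω t') (fun j X z => Sect2.admE P ν M g Λ j (Sect2.domSites P M j X) z) Rz.phi k U =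
      B14.Eq225Concrete.E225 (Sect2.towerOfTerms S Rz M Ω t) (fun j X z => Sect2.admE P ν M g Λ j (Sect2.domSites P M j X) z) Rz.phi k U := by
    unfold B14.Eq225Concrete.E225 B14.Eq225Concrete.EjSub
    refine Finset.sum_congr rfl fun j hj => ?_
    have hjk : j ≤ k := (Finset.mem_Icc.mp hj).2
    simp only [Sect2.towerOfTerms, hE j hjk]
    rfl
  have h2 : B14.Eq225Concrete.R230 (Sect2.towerOfTerms S Rz M Ω t') (fun j X => Sect2.admR P ν M g Λ j (Sect2.domSites P M j X)) k U =
      B14.Eq225Concrete.R230 (Sect2.towerOfTerms S Rz M Ω t) (fun j X => Sect2.admR P ν M g Λ j (Sect2.domSites P M j X)) k U := by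
    unfold B14.Eq225Concrete.R230
    refine Finset.sum_congr rfl fun j hj => ?_
    have hjk : j ≤ k := (Finset.mem_Icc.mp hj).2
    simp only [Sect2.towerOfTerms, hR j hjk]
    rfl
  have h3 : B14.Eq225Concrete.B240 (Sect2.towerOfTerms S Rz M Ω t') (fun j X => Sect2.admB P ν M g Ω Λ j (Sect2.domSites P M j X)) a k U =
      B14.Eq225Concrete.B240 (Sect2.towerOfTerms S Rz M Ω t) (fun j X => Sect2.admB P ν M g Ω Λ j (Sect2.domSites P M j X)) a k U := by
    unfold B14.Eq225Concrete.B240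
    refine Finset.sum_congr rfl fun j hj => ?_
    have hjk : j ≤ k := (Finset.mem_Icc.mp hj).2
    simp only [Sect2.towerOfTerms, hB j hjk]
    rfl
  simp only [Sect2.towerOfTerms] at h1 h2 h3 ⊢
  rw [h1, h2, h3]

end TruncatedWitness


/-! ## §1. Of record — at a no-expansion new step the operand and the slot do not read the witness above level `k` -/

section SlotInvariance

variable {F : T4Family} {N : ℕ} [NeZero N]
variable {𝔸 : Type*} [NormedRing 𝔸] [NormedAlgebra ℂ 𝔸] [CompleteSpace 𝔸]
variable {ν : Stage7Numerics} {M : ℕ} {g : ℕ → ℝ} {K : ℕ}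

/-- **AT A NO-EXPANSION NEW STEP THE OPERAND `e^{A_{k+1}(s′)}` DOES NOT READ THE WITNESS ABOVE LEVEL `k`** (`Ω_{k+1}(s′) = ∅`, `M ≥ 1`; any setting, residual, constant,
background map): dag-n11-d's `action23_succ_eq_init_of_Omega_empty` (the scale-`(k+1)` ranges are empty) on both witnesses, then §0's congruence at `init s′`.
[cite: Balaban1988Convergent, (2.22)–(2.25) pp.258–259, (2.30) p.260, (2.40) p.261, (3.24)–(3.25) p.270] -/
theorem sect2Operand_succ_congr_of_agree_of_Omega_empty {V : Type} (S : Sect2.Setting 𝔸 (SU N)) (Rz : Sect2.Residual (F.P K) 𝔸) (hM : 1 ≤ M)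
    {k : ℕ} (s : SeqOfRecord F ν M g K (k + 1)) (hΩ : s.Ω (k + 1) = ∅) {t t' : Sect2.TermValues (F.P K) 𝔸 V M}
    (hE : ∀ j, j ≤ k → ∀ X z gc φ, t'.E j X z gc φ = t.E j X z gc φ) (hR : ∀ j, j ≤ k → ∀ X φ, t'.R j X φ = t.R j X φ)
    (hB : ∀ j, j ≤ k → ∀ X φ a, t'.B j X φ a = t.B j X φ a) (E : ℝ) (U : BgMap F N K) :
    sect2Operand F N V K S Rz s t' E U = sect2Operand F N V K S Rz s t E U := by
  funext a W
  show Real.exp ((sect2ActionDataOfRecord F N V K S Rz s t' a E).action23 (k + 1) (U W)) =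
    Real.exp ((sect2ActionDataOfRecord F N V K S Rz s t a E).action23 (k + 1) (U W))
  rw [action23_succ_eq_init_of_Omega_empty S Rz hM s hΩ t' a E E (U W), action23_succ_eq_init_of_Omega_empty S Rz hM s hΩ t a E E (U W),
    show (sect2ActionDataOfRecord F N V K S Rz s.init t' a E).action23 k (U W) = (sect2ActionDataOfRecord F N V K S Rz s.init t a E).action23 k (U W) from
      action23_actionDataOfTerms_congr_of_agree S Rz ν g s.init.Ω s.init.Λ hE hR hB a E (U W)]

variable (V : Type) [NormedAddCommGroup V] [InnerProductSpace ℝ V] [FiniteDimensional ℝ V] [MeasurableSpace V] [BorelSpace V]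

/-- **… NOR DOES THE SLOT `𝐓_{k+1}(s′) e^{A_{k+1}(s′)}`** (any weight datum). [cite: Balaban1988Convergent, (2.18) p.257, (2.22)–(2.23) p.258, (3.24)–(3.25) p.270] -/
theorem sect2Slot_succ_congr_of_agree_of_Omega_empty (S : Sect2.Setting 𝔸 (SU N)) (Rz : Sect2.Residual (F.P K) 𝔸) (W : TkWeights F N V K) (hM : 1 ≤ M)
    {k : ℕ} (s : SeqOfRecord F ν M g K (k + 1)) (hΩ : s.Ω (k + 1) = ∅) {t t' : Sect2.TermValues (F.P K) 𝔸 V M}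
    (hE : ∀ j, j ≤ k → ∀ X z gc φ, t'.E j X z gc φ = t.E j X z gc φ) (hR : ∀ j, j ≤ k → ∀ X φ, t'.R j X φ = t.R j X φ)
    (hB : ∀ j, j ≤ k → ∀ X φ a, t'.B j X φ a = t.B j X φ a) (E : ℝ) (U : BgMap F N K) :
    sect2Slot F N V K S Rz W s t' E U = sect2Slot F N V K S Rz W s t E U := by
  unfold sect2Slot
  rw [sect2Operand_succ_congr_of_agree_of_Omega_empty S Rz hM s hΩ hE hR hB E U]

end SlotInvariance

end Summit.QuantumFields.YangMills.Theorems.BalabanUVNodesN11NoExpansionTruncatedWitness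

end
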